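import Summits.AnomalousDissipation.AnomalousDissipation.Theorems.EnsembleRigidityGPStatisticalRigidityPartial
import Literature.Analysis.FluidPDE.StatisticalSolutionEnergyEq
import HarnessLib

/-!
# Energy and enstrophy floors of stationary Euler statistics of `f_GP` — crux
  `TameRoughRigidity.GPEulerCoercive` (stmt-AnomalousDissipation-18400), line `floor_duality_galerkin`,
  tools stub `stub_gpEulerFloorTools`

The crux N = `GPEulerCoercive`: no Borel probability measure on `H = L²_σ(T³)` is a stationary
statistical solution (Foias–Manley–Rosa–Temam class) of the EULER equations forced by the
Galloway–Proctor force `f_GP = sin(2πx₂)e₀ + sin(2πx₀)e₁ + sin(2πx₁)e₂` (`gpForce`).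

This file lands the FIRST RUNG of the line's enstrophy-floor ladder directly, i.e. the partial
result "N holds on the class of statistics of mean enstrophy `< 3π` (or mean energy `< 3/(4π)`)":
every stationary Euler statistics `μ` of `f_GP` has

* mean energy `∫ |v|² dμ ≥ 3/(4π)` (`ensembleEnergy_ge_of_eulerSSS`), and
* mean enstrophy `∫ ‖∇v‖² dμ ≥ 3π` (`ensembleEnstrophy_ge_of_eulerSSS`).

## Proof

The stationary Liouville identity of `μ` (`IsStationaryStatisticalSolution.generator`: zero
cylindrical defect) passes to the FIXED linear test field `w = f_GP` by the landed cut-off removal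
`stub_linearTestLimit` (parent line, `…GPStatisticalRigidityLinearTestLimit.lean`) at `R = 0`:
`∫ ⟨f_GP − B(v,v), f_GP⟩ dμ = 0`. The landed second-moment test `stub_gpSmallEnergy`
(`‖f_GP‖² = 3/2`, pointwise strain `⟨∇f_GP(x) v, v⟩ ≥ −2π|v|²`) at `R = 0` then reads
`3/2 − 2π ∫|v|² dμ ≤ 0`, the energy floor; the spectral Poincaré inequality on `H`
(`norm_sq_le_toReal_eGradNormSq`: `4π²|v|² ≤ ‖∇v‖²`, integrated `μ`-a.e.) turns it into the enstrophy
floor `4π² · 3/(4π) = 3π`. In the language of the line: the linear certificate `Ψ' = (2π)·f_GP` is a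
floor certificate of level `3π` (the horizon of ALL linear certificates read on the first shell;
`Cruxes/GPEulerCoercive/Lines/floor_duality_galerkin.md`, "proved today only for Γ < 3π").

## Contents

* `integral_nsGeneratorPairing_gpForce_eq_zero` — the fixed-test balance at `w = f_GP`.
* `ensembleEnergy_ge_of_eulerSSS`, `ensembleEnstrophy_toReal_ge_of_eulerSSS`,
  `ensembleEnstrophy_ge_of_eulerSSS` — the floors.
* `gpEulerCoercive_smallEnstrophy`, `gpEulerCoercive_smallEnergy` — N on the small classes, in the
  verbatim shape of the route declaration (inline force).
* `stub_gpEulerFloorTools` — the registered tools stub (conjunction).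

## References

* C. Foias, O. Manley, R. Rosa, R. Temam, *Navier–Stokes Equations and Turbulence* (CUP 2001),
  Ch. IV §1.2 Def. 1.3, (1.13), (1.29)–(1.31).
* C. Doering, C. Foias, *Energy dissipation in body-forced turbulence*, JFM 467 (2002), §2 (the
  second-moment test against the force).
-/

-- `Summit.<Summit>.<Problem>` is the tree's mandated summit-side namespace (CONVENTIONS §2); single-conjunct summit, duplicate deliberate.
set_option linter.dupNamespace false

noncomputable section

namespace Summit.AnomalousDissipation.AnomalousDissipation.Theorems.TameRoughRigidity.GPEulerCoercive

open MeasureTheory Filter Topology UnitAddTorus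
open scoped InnerProductSpace RealInnerProductSpace ENNReal NNReal
open Literature.Analysis.FunctionSpaces Literature.Analysis.FluidPDE
open Summit.AnomalousDissipation.AnomalousDissipation.Theorems.EnsembleRigidity
open Summit.AnomalousDissipation.AnomalousDissipation.Theorems.EnsembleRigidity.GPStatisticalRigidity

/-- Local notation: real vector fields on `T³`. -/
local notation "Vec3" => (UnitAddTorus (Fin 3)) → (EuclideanSpace ℝ (Fin 3))
/-- Local notation: `L²(T³; ℝ³)`. -/
local notation "L2" => (Lp (EuclideanSpace ℝ (Fin 3)) 2 (volume : Measure (UnitAddTorus (Fin 3))))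
/-- Local notation: the energy space `H`. -/
local notation "H3" => (Torus.energySpace (Fin 3))

/-! ## The fixed-test balance at `w = f_GP` -/

/-- **Zero defect against the force itself.** For a stationary Euler statistics `μ` of `f_GP`, the
generator tested against the fixed field `f_GP` integrates to zero:
`∫ ⟨f_GP − B(v,v), f_GP⟩ dμ = 0` (cut-off removal `stub_linearTestLimit` at `R = 0`). [folklore] -/
theorem integral_nsGeneratorPairing_gpForce_eq_zero {μ : Measure H3}
    (hμ : Torus.IsStationaryStatisticalSolution 0 gpForce μ) :
    Integrable (fun v : H3 => Torus.nsGeneratorPairing 0 gpForce v gpForce) μ ∧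
      ∫ v, Torus.nsGeneratorPairing 0 gpForce v gpForce ∂μ = 0 := by
  haveI := hμ.prob
  obtain ⟨hsm, hdf, hzm⟩ := gpForce_admissible
  have hf2 : MemLp gpForce 2 volume := hsm.memLp 2
  have hdef : ∀ Φ : Torus.CylindricalTest (Fin 3),
      Integrable (fun v : H3 => Torus.nsGeneratorPairing 0 gpForce v (Φ.grad v)) μ ∧
        |∫ v, Torus.nsGeneratorPairing 0 gpForce v (Φ.grad v) ∂μ| ≤
          0 * Real.sqrt (∫ v, Torus.gradNormSq (Φ.grad v) ∂μ) := by
    intro Φ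
    obtain ⟨hI, h0⟩ := hμ.generator Φ
    refine ⟨hI, ?_⟩
    rw [h0, abs_zero, zero_mul]
  obtain ⟨hI, hle⟩ :=
    stub_linearTestLimit gpForce gpForce hf2 hsm hdf hzm μ hμ.prob hμ.integrable_norm_sq 0 hdef
  refine ⟨hI, ?_⟩
  rw [zero_mul] at hle
  exact abs_eq_zero.1 (le_antisymm hle (abs_nonneg _))

/-! ## The floors -/

/-- **Energy floor.** Every stationary Euler statistics of `f_GP` has mean energy
`∫ |v|² dμ ≥ 3/(4π)` (second-moment test `stub_gpSmallEnergy` at zero defect). [folklore] -/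
theorem ensembleEnergy_ge_of_eulerSSS {μ : Measure H3}
    (hμ : Torus.IsStationaryStatisticalSolution 0 gpForce μ) :
    3 / (4 * Real.pi) ≤ Torus.ensembleEnergy μ := by
  have hpi : 0 < Real.pi := Real.pi_pos
  obtain ⟨-, h0⟩ := integral_nsGeneratorPairing_gpForce_eq_zero hμ
  have hbal : |∫ v, Torus.nsGeneratorPairing 0 gpForce v gpForce ∂μ| ≤
      0 * Real.sqrt (Torus.gradNormSq gpForce) := by
    rw [h0, abs_zero, zero_mul]
  have hS := stub_gpSmallEnergy gpForce rfl (Torus.ensembleEnergy μ) μ hμ.prob hμ.integrable_norm_sq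
    le_rfl 0 hbal
  have hden : 0 < Real.pi * Real.sqrt 6 := by positivity
  have hnum : 3 / 2 - 2 * Real.pi * Torus.ensembleEnergy μ ≤ 0 := by
    by_contra hcon
    rw [not_le] at hcon
    have : 0 < (3 / 2 - 2 * Real.pi * Torus.ensembleEnergy μ) / (Real.pi * Real.sqrt 6) :=
      div_pos hcon hden
    linarith
  rw [div_le_iff₀ (by positivity)]
  nlinarith

/-- **Enstrophy floor, real form.** Every stationary Euler statistics of `f_GP` has mean enstrophy
`(∫ ‖∇v‖² dμ).toReal ≥ 3π` (energy floor and the spectral Poincaré inequality `4π²|v|² ≤ ‖∇v‖²` on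
`H`, integrated `μ`-a.e.). [folklore] -/
theorem ensembleEnstrophy_toReal_ge_of_eulerSSS {μ : Measure H3}
    (hμ : Torus.IsStationaryStatisticalSolution 0 gpForce μ) :
    3 * Real.pi ≤ (Torus.ensembleEnstrophy μ).toReal := by
  haveI := hμ.prob
  have hpi : 0 < Real.pi := Real.pi_pos
  -- Poincaré, integrated
  have hP : 4 * Real.pi ^ 2 * Torus.ensembleEnergy μ ≤ (Torus.ensembleEnstrophy μ).toReal := by
    have hae : ∀ᵐ u : H3 ∂μ, 4 * Real.pi ^ 2 * ‖u‖ ^ 2 ≤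
        (Torus.eGradNormSq ((u : L2) : Vec3)).toReal := by
      filter_upwards [hμ.ae_eGradNormSq_lt_top] with u hu
      exact Torus.norm_sq_le_toReal_eGradNormSq u hu.ne
    have hmono := integral_mono_ae (hμ.integrable_norm_sq.const_mul (4 * Real.pi ^ 2))
      hμ.integrable_toReal_eGradNormSq hae
    have hGa : ∫ u : H3, (Torus.eGradNormSq ((u : L2) : Vec3)).toReal ∂μ =
        (Torus.ensembleEnstrophy μ).toReal := by
      rw [Torus.ensembleEnstrophy,
        integral_toReal Torus.measurable_eGradNormSq_coe.aemeasurable hμ.ae_eGradNormSq_lt_top]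
    rw [integral_const_mul, hGa] at hmono
    unfold Torus.ensembleEnergy
    exact hmono
  have hE := ensembleEnergy_ge_of_eulerSSS hμ
  have h3 : 4 * Real.pi ^ 2 * (3 / (4 * Real.pi)) = 3 * Real.pi := by
    field_simp
  nlinarith [mul_le_mul_of_nonneg_left hE (by positivity : (0 : ℝ) ≤ 4 * Real.pi ^ 2)]

/-- **Enstrophy floor.** Every stationary Euler statistics of `f_GP` has mean enstrophy
`∫ ‖∇v‖² dμ ≥ 3π` in `ℝ≥0∞`. [folklore] -/
theorem ensembleEnstrophy_ge_of_eulerSSS {μ : Measure H3}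
    (hμ : Torus.IsStationaryStatisticalSolution 0 gpForce μ) :
    ENNReal.ofReal (3 * Real.pi) ≤ Torus.ensembleEnstrophy μ :=
  ENNReal.ofReal_le_of_le_toReal (ensembleEnstrophy_toReal_ge_of_eulerSSS hμ)

/-! ## N on the small classes, verbatim shape -/

/-- **`GPEulerCoercive` below the enstrophy horizon `3π`**: in the verbatim shape of the route
declaration (inline force), no probability measure of mean enstrophy `< 3π` is a stationary Euler
statistics of `f_GP`. [folklore] -/
theorem gpEulerCoercive_smallEnstrophy (f : Vec3)
    (hf : f = (fun x : UnitAddTorus (Fin 3) =>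
      (Literature.Analysis.FluidPDE.Torus.stokesMode (Pi.single (2 : Fin 3) (1 : ℤ))
          (EuclideanSpace.single (0 : Fin 3) (1 : ℝ)) false x +
        Literature.Analysis.FluidPDE.Torus.stokesMode (Pi.single (0 : Fin 3) (1 : ℤ))
          (EuclideanSpace.single (1 : Fin 3) (1 : ℝ)) false x +
        Literature.Analysis.FluidPDE.Torus.stokesMode (Pi.single (1 : Fin 3) (1 : ℤ))
          (EuclideanSpace.single (2 : Fin 3) (1 : ℝ)) false x : EuclideanSpace ℝ (Fin 3))))
    (μ : Measure H3) (hG : Torus.ensembleEnstrophy μ < ENNReal.ofReal (3 * Real.pi)) :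
    ¬ Torus.IsStationaryStatisticalSolution 0 f μ := by
  have hf' : f = gpForce := hf.trans gpForce_eq.symm
  subst hf'
  intro hμ
  exact absurd (ensembleEnstrophy_ge_of_eulerSSS hμ) (not_le.2 hG)

/-- **`GPEulerCoercive` below the energy horizon `3/(4π)`**: no measure of mean energy `< 3/(4π)` is a
stationary Euler statistics of `f_GP` (for a statistics the energy is integrable, so `ensembleEnergy`
carries no junk value here). [folklore] -/
theorem gpEulerCoercive_smallEnergy (f : Vec3)
    (hf : f = (fun x : UnitAddTorus (Fin 3) =>
      (Literature.Analysis.FluidPDE.Torus.stokesMode (Pi.single (2 : Fin 3) (1 : ℤ))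
          (EuclideanSpace.single (0 : Fin 3) (1 : ℝ)) false x +
        Literature.Analysis.FluidPDE.Torus.stokesMode (Pi.single (0 : Fin 3) (1 : ℤ))
          (EuclideanSpace.single (1 : Fin 3) (1 : ℝ)) false x +
        Literature.Analysis.FluidPDE.Torus.stokesMode (Pi.single (1 : Fin 3) (1 : ℤ))
          (EuclideanSpace.single (2 : Fin 3) (1 : ℝ)) false x : EuclideanSpace ℝ (Fin 3))))
    (μ : Measure H3) (hE : Torus.ensembleEnergy μ < 3 / (4 * Real.pi)) :
    ¬ Torus.IsStationaryStatisticalSolution 0 f μ := by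
  have hf' : f = gpForce := hf.trans gpForce_eq.symm
  subst hf'
  intro hμ
  exact absurd (ensembleEnergy_ge_of_eulerSSS hμ) (not_le.2 hE)

/-! ## The registered tools stub -/

/-- **Tools stub `stub_gpEulerFloorTools`** (registered on stmt-AnomalousDissipation-18400, line
`floor_duality_galerkin`): the floors of stationary Euler statistics of `f_GP` — mean energy
`≥ 3/(4π)` and mean enstrophy `≥ 3π` — i.e. the crux N on the classes of small energy / small
enstrophy (the first rung of the enstrophy-floor ladder, realised by the linear certificate
`Ψ' = 2π f_GP`). [folklore] -/
theorem stub_gpEulerFloorTools :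
    (∀ μ : Measure H3, Torus.IsStationaryStatisticalSolution 0 gpForce μ → 3 / (4 * Real.pi) ≤ Torus.ensembleEnergy μ ∧ ENNReal.ofReal (3 * Real.pi) ≤ Torus.ensembleEnstrophy μ) ∧ (∀ f : Vec3, f = gpForce → ∀ μ : Measure H3, Torus.ensembleEnstrophy μ < ENNReal.ofReal (3 * Real.pi) → ¬ Torus.IsStationaryStatisticalSolution 0 f μ) :=
  ⟨fun _ hμ => ⟨ensembleEnergy_ge_of_eulerSSS hμ, ensembleEnstrophy_ge_of_eulerSSS hμ⟩,
    fun f hf μ hG => gpEulerCoercive_smallEnstrophy f (hf.trans gpForce_eq) μ hG⟩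

end Summit.AnomalousDissipation.AnomalousDissipation.Theorems.TameRoughRigidity.GPEulerCoercive

end
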